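import Mathlib
import Summits.NavierStokesRegularity.NavierStokesRegularity.Theorems.TaoLadderRungTwoFlatDeepBehind
import Summits.NavierStokesRegularity.NavierStokesRegularity.Theorems.TaoLadderRungTwoFlatTubeStepLandSplit
import HarnessLib

/-!
# K4, TUBE HOPS (horizons `s ≤ c₀`): the a-priori weighted bound along every exact flow from a ball state of a tube hop `n > N₀`, from
  ZONE LEVELS (behind plain levels of at most exponential growth with depth + window hull, as hypotheses over the whole `[0, s]`), the frozen
  deep-behind amplitudes (`deepBehind_plain_sup`) and the cut schedule ahead (`aheadCuts_of_schedule` at horizon `s`)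
  (helper for the K_A♭ parent item stmt-NavierStokesRegularity-22987 `FlatGapCertificatesV2`, child 2A `GradedAdiabaticWakeA` of route
  TaoLadderRungTwoFlat; cell harvest/h2-tao-ladder, p1 g25; LADDER §47.5 L2, §50 (`TubeExist`, K4), §54, §62)

The `hapr` clause of `tubeExistWith_of_apriori` at a tube hop asks, for each tube state `z` and ball state `S₀`, ONE number `B` bounding
`ω_k|S_{ik}(t)|` along every exact flow from `S₀` on every `[0, s] ⊆ [0, c]`. This module produces it for the horizons `s ≤ c₀` from:
(i) ZONE LEVELS `hlev` — along every such flow, plain amplitude levels `Hb k` behind the window (`k < −K`, growing at most like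
`C_b·e^{θ_b'(−K−k)}` with `θ_b' < (5/2)log(1+ε₀)`: the shape the block energies of the behind loops give, `√(2W̄)e^{θ′|k+K|/2}`) and hull
levels `Hk k` on `[−K, k_H+1]` (near block + interface + E2 window), valid on the whole `[0, s]` (not only up to a good time);
(ii) the frozen deep-behind amplitudes: below a state-dependent shell `k⋆(z)` (`exists_deep_shell`: the clocks beat the exponential growth
of the behind levels) the plain amplitudes stay `≤ 2Λ₁` by `deepBehind_plain_sup`;
(iii) the cut schedule AHEAD at horizon `s` (`aheadCuts_of_schedule` with `c₀ := s`; its rows at `c₀` imply those at `s ≤ c₀`).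
The horizons `s ∈ (c₀, c]` (continuation past the landing) are the business of `…ExistTubeGlue`.

* `exists_deep_shell` — a shell `k⋆ ≤ k_max` with `A·c_{k⋆}·(Λ₀ + C_b e^{θ_b'(−K−k⋆−1)} + 1) ≤ 1`;
* `apriori_tube_of_levels` — the `hapr` clause at a tube hop `n > N₀` for horizons `s ≤ c₀`.

HONEST FRAMING: soft analysis over the cell's typed induction frame (MODEL lattice, graded mirror table on `S♭`); the zone levels and rows are
HYPOTHESES; nothing certified; no item closed; nothing about the Navier–Stokes equations.
-/

noncomputable section

-- the sub-problem namespace repeats the summit name by design (D-0017)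
set_option linter.dupNamespace false

namespace Summit.NavierStokesRegularity.NavierStokesRegularity.Theorems.HopTube

open Set Finset Filter Topology Literature.Analysis.FluidPDE Literature.Analysis.FluidPDE.TaoCascade MirrorPulse RenormFrame QuadPolar
  GappedFrontRobustOn

/-- **A deep shell where the clocks beat the behind levels**: for `0 < ε₀`, `0 ≤ θ_b' < (5/2)·log(1+ε₀)`, `A, Λ₀, C_b ≥ 0` and any `k_max`
there is `k⋆ ≤ k_max` with `A·c_{k⋆}·(Λ₀ + C_b·e^{θ_b'(−K−k⋆−1)} + 1) ≤ 1`.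
[cite: Tao2016AveragedNS, §4 (4.8) (clocks); folklore (exponentials); cell LADDER §54 (slow behind exponent)] -/
theorem exists_deep_shell {ε₀ θb' A Λ₀ Cb : ℝ} (hε₀ : 0 < ε₀) (hθb0 : 0 ≤ θb') (hθb : θb' < 5 / 2 * Real.log (1 + ε₀))
    (hA : 0 ≤ A) (hΛ₀ : 0 ≤ Λ₀) (hCb : 0 ≤ Cb) (K : ℕ) (kmax : ℤ) :
    ∃ kstar : ℤ, kstar ≤ kmax ∧
      A * clockW ε₀ kstar * (Λ₀ + Cb * Real.exp (θb' * (-(K : ℝ) - kstar - 1)) + 1) ≤ 1 := by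
  have hq : 0 < 1 + ε₀ := by linarith
  set L : ℝ := Real.log (1 + ε₀) with hL
  have hL0 : 0 < L := Real.log_pos (by linarith)
  set ρ : ℝ := 5 / 2 * L - θb' with hρ
  have hρ0 : 0 < ρ := by rw [hρ]; linarith
  set D : ℝ := A * (Λ₀ + 1 + Cb) + 1 with hD
  have hD1 : 1 ≤ D := by rw [hD]; nlinarith
  have hD0 : 0 < D := by linarith
  set kstar : ℤ := min kmax (min 0 ⌊Real.log (1 / D) / ρ⌋) with hk
  refine ⟨kstar, min_le_left _ _, ?_⟩
  have hk0 : kstar ≤ 0 := (min_le_right _ _).trans (min_le_left _ _)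
  have hkf : (kstar : ℝ) ≤ Real.log (1 / D) / ρ := by
    have h1 : kstar ≤ ⌊Real.log (1 / D) / ρ⌋ := (min_le_right _ _).trans (min_le_right _ _)
    have h2 : (kstar : ℝ) ≤ (⌊Real.log (1 / D) / ρ⌋ : ℝ) := by exact_mod_cast h1
    exact h2.trans (Int.floor_le _)
  have hk0R : (kstar : ℝ) ≤ 0 := by exact_mod_cast hk0
  -- `e^{ρ k⋆} ≤ 1/D`
  have hexpρ : Real.exp (ρ * kstar) ≤ 1 / D := by
    have h1 : ρ * kstar ≤ Real.log (1 / D) := by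
      have := mul_le_mul_of_nonneg_left hkf hρ0.le
      rwa [mul_div_cancel₀ _ hρ0.ne'] at this
    calc Real.exp (ρ * kstar) ≤ Real.exp (Real.log (1 / D)) := Real.exp_le_exp.mpr h1
      _ = 1 / D := Real.exp_log (by positivity)
  -- the two pieces against `e^{ρ k⋆}`
  have hclock : clockW ε₀ kstar = Real.exp (5 / 2 * L * kstar) := by
    unfold clockW; rw [Real.rpow_def_of_pos hq, hL]; ring_nf
  have hc1 : clockW ε₀ kstar ≤ Real.exp (ρ * kstar) := by
    rw [hclock]; apply Real.exp_le_exp.mpr; rw [hρ]; nlinarith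
  have hc2 : clockW ε₀ kstar * Real.exp (θb' * (-(K : ℝ) - kstar - 1)) ≤ Real.exp (ρ * kstar) := by
    rw [hclock, ← Real.exp_add]
    apply Real.exp_le_exp.mpr
    rw [hρ]
    have : 0 ≤ θb' * ((K : ℝ) + 1) := by positivity
    nlinarith
  have hcpos : 0 ≤ clockW ε₀ kstar := (clockW_pos (by linarith) kstar).le
  -- assemble
  have hmain : clockW ε₀ kstar * (Λ₀ + Cb * Real.exp (θb' * (-(K : ℝ) - kstar - 1)) + 1) ≤ (Λ₀ + 1 + Cb) * Real.exp (ρ * kstar) := by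
    have h1 : clockW ε₀ kstar * (Λ₀ + 1) ≤ (Λ₀ + 1) * Real.exp (ρ * kstar) := by nlinarith
    have h2 : clockW ε₀ kstar * (Cb * Real.exp (θb' * (-(K : ℝ) - kstar - 1))) ≤ Cb * Real.exp (ρ * kstar) := by
      have := mul_le_mul_of_nonneg_left hc2 hCb
      linarith [this]
    nlinarith
  calc A * clockW ε₀ kstar * (Λ₀ + Cb * Real.exp (θb' * (-(K : ℝ) - kstar - 1)) + 1)
      = A * (clockW ε₀ kstar * (Λ₀ + Cb * Real.exp (θb' * (-(K : ℝ) - kstar - 1)) + 1)) := by ring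
    _ ≤ A * ((Λ₀ + 1 + Cb) * Real.exp (ρ * kstar)) := mul_le_mul_of_nonneg_left hmain hA
    _ ≤ D * (1 / D) := by
        have h3 : A * (Λ₀ + 1 + Cb) ≤ D := by rw [hD]; linarith
        have h4 : 0 ≤ Real.exp (ρ * kstar) := (Real.exp_pos _).le
        calc A * ((Λ₀ + 1 + Cb) * Real.exp (ρ * kstar)) = (A * (Λ₀ + 1 + Cb)) * Real.exp (ρ * kstar) := by ring
          _ ≤ D * Real.exp (ρ * kstar) := mul_le_mul_of_nonneg_right h3 h4
          _ ≤ D * (1 / D) := mul_le_mul_of_nonneg_left hexpρ hD0.le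
    _ = 1 := by field_simp

section Tube

variable {ε ε₀ : ℝ}

/-- **K4 AT A TUBE HOP (horizons `s ≤ c₀`): the a-priori `ω`-bound from zone levels.** See the module docstring. Output: the `hapr` clause of
`tubeExistWith_of_apriori` at hop `n > N₀`, restricted to `s ≤ c₀`.
[cite: Tao2016AveragedNS, §4 Lemma 4.1 (4.5), (4.8), §5, §6.2 Prop. 6.3 (ix); route TaoLadderRungTwoFlat, `HopTube.TubeExistWith` (cell LADDER §47.5 L2, K4; §54; §62)] -/
theorem apriori_tube_of_levels (P : TubeSchedule) {Bcl : ℕ → (Fin 2 → ℤ → ℝ) → Prop} {i₀ : Fin 2} {X₀ : Fin 2 → ℝ}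
    {w ω : ℤ → ℝ} {r c₀ : ℝ} {ζ : ℕ → Fin 2 → ℤ → ℝ} {ustar : Fin 2 → ℤ → ℝ} {n : ℕ}
    (hε : 0 ≤ ε) (hε₀ : 0 < ε₀) (hc₀ : 0 < c₀) (hn : P.N₀ < n) (hr0 : 0 ≤ r) (hw1 : ∀ k, 1 ≤ w k)
    -- the Banach weight: nonnegative, dominated by `Ω_w·w`, bounded by `Ω_b` behind the window
    {Ωw Ωb : ℝ} (hω0 : ∀ k, 0 ≤ ω k) (hΩw : 0 ≤ Ωw) (hωw : ∀ k, ω k ≤ Ωw * w k) (hΩb : 0 ≤ Ωb)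
    (hωb : ∀ k, k < -(P.K : ℤ) → ω k ≤ Ωb)
    -- the tube state's own `ω`-bound and behind cap
    (hzω : ∀ z, InTubeWith P Bcl i₀ X₀ w r ζ ustar n z → ∃ Bz : ℝ, ∀ i k, ω k * |z i k| ≤ Bz)
    (hcap : ∀ z, InTubeWith P Bcl i₀ X₀ w r ζ ustar n z → ∃ Λ : ℝ, 0 ≤ Λ ∧ ∀ (i : Fin 2) (k : ℤ), k < -(P.K : ℤ) → |z i k| ≤ Λ)
    -- ZONE LEVELS along every exact flow from a ball state on `[0, s]`, `s ≤ c₀`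
    {Hk Hb : ℤ → ℝ} {Cb θb' BH : ℝ} {kH : ℤ} (hKH : -(P.K : ℤ) ≤ kH + 1)
    (hlev : ∀ z S₀ s S F, InTubeWith P Bcl i₀ X₀ w r ζ ustar n z → (∀ i k, w k * |S₀ i k - z i k| ≤ r) → 0 < s → s ≤ c₀ →
      PseudoFlowOnShift shiftSetFlat s ε₀ (mirrorTable ε ε) 0 0 S₀ (fun i k => (1 / 2) * S₀ i k ^ 2) (fun _ _ => 0) S F →
        ∀ t ∈ Icc 0 s, ∀ (i : Fin 2) (k : ℤ),
          (k < -(P.K : ℤ) → |S i k t| ≤ Hb k) ∧ (-(P.K : ℤ) ≤ k → k ≤ kH + 1 → |S i k t| ≤ Hk k))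
    (hCb : 0 ≤ Cb) (hθb0 : 0 ≤ θb') (hθb : θb' < 5 / 2 * Real.log (1 + ε₀))
    (hHb : ∀ k : ℤ, k < -(P.K : ℤ) → Hb k ≤ Cb * Real.exp (θb' * (-(P.K : ℝ) - k)))
    (hHω : ∀ k : ℤ, -(P.K : ℤ) ≤ k → k ≤ kH + 1 → ω k * Hk k ≤ BH)
    -- AHEAD: the cut schedule (rows at horizon `c₀`), window-top hull `Hk (k_H+1) ≤ Vtop`, `ω·2G ≤ B_G` beyond
    {Vtop BG : ℝ} {G Ω : ℤ → ℝ} (hk₁H : (P.k₁ : ℤ) ≤ kH + 2) (hVtop : 0 ≤ Vtop) (hHV : Hk (kH + 1) ≤ Vtop)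
    (hG0 : ∀ j, kH < j → 0 ≤ G j)
    (hΩ : ∀ j, kH < j → ∀ N : Finset ℤ, (∀ m ∈ N, j < m) → ∑ m ∈ N, (w m)⁻¹ ^ 2 ≤ Ω j)
    (hGΩ : ∀ j, kH < j → 2 * (9 / 8 * r) ^ 2 * Ω j ≤ G j ^ 2)
    (hclose0 : 4 / 3 * c₀ * clock ε₀ (kH + 1) * Vtop * (Vtop + 2 * ε * G (kH + 1)) < G (kH + 1))
    (hcloseG : ∀ j, kH + 1 ≤ j →
      4 / 3 * c₀ * clock ε₀ (j + 1) * (2 * G j) * (2 * G j + 2 * ε * G (j + 1)) < G (j + 1))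
    (hGω : ∀ k : ℤ, kH + 1 < k → ω k * (2 * G (k - 1)) ≤ BG)
    {z S₀ : Fin 2 → ℤ → ℝ} (hz : InTubeWith P Bcl i₀ X₀ w r ζ ustar n z) (hkick : ∀ i k, w k * |S₀ i k - z i k| ≤ r) :
    ∃ B : ℝ, (∀ (i : Fin 2) (k : ℤ), ω k * |S₀ i k| ≤ B) ∧
      ∀ s : ℝ, 0 < s → s ≤ c₀ → ∀ S F : Fin 2 → ℤ → ℝ → ℝ,
        PseudoFlowOnShift shiftSetFlat s ε₀ (mirrorTable ε ε) 0 0 S₀ (fun i k => (1 / 2) * S₀ i k ^ 2) (fun _ _ => 0) S F →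
          ∀ t ∈ Icc 0 s, ∀ (i : Fin 2) (k : ℤ), ω k * |S i k t| ≤ B := by
  have hε' : (-1 : ℝ) < ε₀ := by linarith
  have hcpos : ∀ k, 0 < clockW ε₀ k := clockW_pos hε'
  have hw0 : ∀ k, 0 < w k := fun k => lt_of_lt_of_le one_pos (hw1 k)
  have hT0 : 0 ≤ tableAbsSum shiftSetFlat (mirrorTable ε ε) := tableAbsSum_nonneg _ _
  obtain ⟨Bz, hBz⟩ := hzω z hz
  obtain ⟨Λ, hΛ0, hΛ⟩ := hcap z hz
  -- the ball state: `ω|S₀| ≤ Bz + Ω_w r`, and `|S₀| ≤ Λ + r` behind the window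
  have hkick' : ∀ i k, |S₀ i k - z i k| ≤ r / w k := fun i k => by
    rw [le_div_iff₀ (hw0 k), mul_comm]; exact hkick i k
  have hS₀ω : ∀ (i : Fin 2) (k : ℤ), ω k * |S₀ i k| ≤ Bz + Ωw * r := by
    intro i k
    have htri : |S₀ i k| ≤ |z i k| + |S₀ i k - z i k| := by
      have := abs_add_le (z i k) (S₀ i k - z i k); simp only [add_sub_cancel] at this; exact this
    have hωr : ω k * (r / w k) ≤ Ωw * r := by
      calc ω k * (r / w k) ≤ Ωw * w k * (r / w k) := mul_le_mul_of_nonneg_right (hωw k) (div_nonneg hr0 (hw0 k).le)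
        _ = Ωw * (w k * r / w k) := by ring
        _ = Ωw * r := by rw [mul_div_cancel_left₀ r (hw0 k).ne']
    calc ω k * |S₀ i k| ≤ ω k * (|z i k| + |S₀ i k - z i k|) := mul_le_mul_of_nonneg_left htri (hω0 k)
      _ ≤ ω k * |z i k| + ω k * (r / w k) := by rw [mul_add]; exact add_le_add le_rfl (mul_le_mul_of_nonneg_left (hkick' i k) (hω0 k))
      _ ≤ Bz + Ωw * r := add_le_add (hBz i k) hωr
  have hS₀b : ∀ (i : Fin 2) (k : ℤ), k < -(P.K : ℤ) → |S₀ i k| ≤ Λ + r := by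
    intro i k hk
    have htri : |S₀ i k| ≤ |z i k| + |S₀ i k - z i k| := by
      have := abs_add_le (z i k) (S₀ i k - z i k); simp only [add_sub_cancel] at this; exact this
    have : r / w k ≤ r := div_le_self hr0 (hw1 k)
    linarith [hΛ i k hk, hkick' i k]
  -- the deep shell
  obtain ⟨kstar, hkstar, hdeep⟩ := exists_deep_shell (A := 8 * c₀ * tableAbsSum shiftSetFlat (mirrorTable ε ε)) hε₀ hθb0 hθb
    (by positivity) (by positivity : 0 ≤ Λ + r) hCb P.K (-(P.K : ℤ) - 2)
  set Λ₁ : ℝ := Λ + r + Cb * Real.exp (θb' * (-(P.K : ℝ) - kstar - 1)) + 1 with hΛ₁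
  have hE0 : 0 ≤ Cb * Real.exp (θb' * (-(P.K : ℝ) - kstar - 1)) := mul_nonneg hCb (Real.exp_pos _).le
  have hΛ₁0 : 0 < Λ₁ := by rw [hΛ₁]; linarith
  -- the bound
  set B : ℝ := 2 * Ωb * Λ₁ + |BH| + |BG| + (|Bz| + Ωw * r) with hB
  have hB1 : 2 * Ωb * Λ₁ ≤ B := by rw [hB]; have := abs_nonneg BH; have := abs_nonneg BG; have := abs_nonneg Bz; nlinarith
  have hB2 : BH ≤ B := by rw [hB]; have := le_abs_self BH; have := abs_nonneg BG; have := abs_nonneg Bz; nlinarith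
  have hB3 : BG ≤ B := by rw [hB]; have := le_abs_self BG; have := abs_nonneg BH; have := abs_nonneg Bz; nlinarith
  have hB4 : Bz + Ωw * r ≤ B := by rw [hB]; have := le_abs_self Bz; have := abs_nonneg BH; have := abs_nonneg BG; nlinarith
  refine ⟨B, fun i k => (hS₀ω i k).trans hB4, fun s hs hsc S F hS t ht i k => ?_⟩
  -- levels along this flow
  have hlevS := hlev z S₀ s S F hz hkick hs hsc hS
  rcases lt_or_ge k (-(P.K : ℤ)) with hkB | hkB
  · -- behind the window: frozen below `k⋆`, exponential levels above
    have hbound : |S i k t| ≤ 2 * Λ₁ := by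
      rcases le_or_gt k kstar with hkd | hkd
      · -- deep: frozen
        refine deepBehind_plain_sup isNearestNeighbourSet_shiftSetFlat hS hε₀ hΛ₁0 (kstar := kstar) ?_ ?_ ?_ i k hkd t ht
        · intro j k' hk'
          have := hS₀b j k' (by omega)
          rw [hΛ₁]; linarith
        · intro j u hu
          have h1 := (hlevS u hu j (kstar + 1)).1 (by omega)
          have h2 := hHb (kstar + 1) (by omega)
          have e : (-(P.K : ℝ) - ((kstar + 1 : ℤ) : ℝ)) = -(P.K : ℝ) - kstar - 1 := by push_cast; ring
          rw [e] at h2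
          rw [hΛ₁]; linarith
        · calc 8 * s * tableAbsSum shiftSetFlat (mirrorTable ε ε) * clockW ε₀ kstar * Λ₁
              ≤ 8 * c₀ * tableAbsSum shiftSetFlat (mirrorTable ε ε) * clockW ε₀ kstar * Λ₁ := by
                have := (hcpos kstar).le
                apply mul_le_mul_of_nonneg_right _ hΛ₁0.le
                apply mul_le_mul_of_nonneg_right _ this
                nlinarith
            _ = 8 * c₀ * tableAbsSum shiftSetFlat (mirrorTable ε ε) * clockW ε₀ kstar
                * (Λ + r + Cb * Real.exp (θb' * (-(P.K : ℝ) - kstar - 1)) + 1) := by rw [hΛ₁]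
            _ ≤ 1 := hdeep
      · -- between `k⋆` and the window bottom: the exponential levels, dominated by the one at `k⋆ + 1`
        have h1 := (hlevS t ht i k).1 hkB
        have h2 := hHb k hkB
        have hmono : Real.exp (θb' * (-(P.K : ℝ) - k)) ≤ Real.exp (θb' * (-(P.K : ℝ) - kstar - 1)) := by
          apply Real.exp_le_exp.mpr
          have : ((kstar + 1 : ℤ) : ℝ) ≤ k := by exact_mod_cast hkd
          push_cast at this
          nlinarith
        have h3 : Cb * Real.exp (θb' * (-(P.K : ℝ) - k)) ≤ Cb * Real.exp (θb' * (-(P.K : ℝ) - kstar - 1)) :=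
          mul_le_mul_of_nonneg_left hmono hCb
        rw [hΛ₁]; linarith
    calc ω k * |S i k t| ≤ Ωb * (2 * Λ₁) := mul_le_mul (hωb k hkB) hbound (abs_nonneg _) hΩb
      _ = 2 * Ωb * Λ₁ := by ring
      _ ≤ B := hB1
  rcases le_or_gt k (kH + 1) with hkW | hkW
  · -- the window: hull levels
    have h1 := (hlevS t ht i k).2 hkB hkW
    calc ω k * |S i k t| ≤ ω k * Hk k := mul_le_mul_of_nonneg_left h1 (hω0 k)
      _ ≤ BH := hHω k hkB hkW
      _ ≤ B := hB2
  · -- ahead: the cut schedule at horizon `s`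
    have hVt : ∀ z' S₀' τ' S' F', HopPremiseWith P Bcl shiftSetFlat ε₀ i₀ (mirrorTable ε ε) X₀ w r s ζ ustar n z' S₀' τ' S' F' →
        ∀ u ∈ Icc 0 s, |S' 1 (kH + 1) u| ≤ Vtop := by
      intro z' S₀' τ' S' F' hprem u hu
      obtain ⟨hz', hkick'', hsτ, hflow⟩ := hprem
      have hflow' := pseudoFlowOnShift_mono hflow hs hsτ
      exact (((hlev z' S₀' s S' F' hz' hkick'' hs hsc hflow' u hu 1 (kH + 1)).2 hKH le_rfl).trans hHV)
    have hinit := initialTails_of_premise_slot (ε := ε) (ε₀ := ε₀) (Bcl := Bcl) (i₀ := i₀) (X₀ := X₀) (c₀ := s) (ζ := ζ)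
      (ustar := ustar) P hn hw0 hr0 hk₁H hΩ hGΩ
    have hmono4 : ∀ (X : ℝ), 0 ≤ X → 4 / 3 * s * X ≤ 4 / 3 * c₀ * X := fun X hX =>
      mul_le_mul_of_nonneg_right (by linarith) hX
    have hclose0' : 4 / 3 * s * clock ε₀ (kH + 1) * Vtop * (Vtop + 2 * ε * G (kH + 1)) < G (kH + 1) := by
      have hX : 0 ≤ clock ε₀ (kH + 1) * Vtop * (Vtop + 2 * ε * G (kH + 1)) := by
        have := clock_nonneg hε'.le (kH + 1); have := hG0 (kH + 1) (by omega); positivity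
      have h1 := hmono4 _ hX
      calc 4 / 3 * s * clock ε₀ (kH + 1) * Vtop * (Vtop + 2 * ε * G (kH + 1))
          = 4 / 3 * s * (clock ε₀ (kH + 1) * Vtop * (Vtop + 2 * ε * G (kH + 1))) := by ring
        _ ≤ 4 / 3 * c₀ * (clock ε₀ (kH + 1) * Vtop * (Vtop + 2 * ε * G (kH + 1))) := h1
        _ = 4 / 3 * c₀ * clock ε₀ (kH + 1) * Vtop * (Vtop + 2 * ε * G (kH + 1)) := by ring
        _ < G (kH + 1) := hclose0
    have hcloseG' : ∀ j, kH + 1 ≤ j → 4 / 3 * s * clock ε₀ (j + 1) * (2 * G j) * (2 * G j + 2 * ε * G (j + 1)) < G (j + 1) := by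
      intro j hj
      have hX : 0 ≤ clock ε₀ (j + 1) * (2 * G j) * (2 * G j + 2 * ε * G (j + 1)) := by
        have := clock_nonneg hε'.le (j + 1); have := hG0 j (by omega); have := hG0 (j + 1) (by omega); positivity
      have h1 := hmono4 _ hX
      calc 4 / 3 * s * clock ε₀ (j + 1) * (2 * G j) * (2 * G j + 2 * ε * G (j + 1))
          = 4 / 3 * s * (clock ε₀ (j + 1) * (2 * G j) * (2 * G j + 2 * ε * G (j + 1))) := by ring
        _ ≤ 4 / 3 * c₀ * (clock ε₀ (j + 1) * (2 * G j) * (2 * G j + 2 * ε * G (j + 1))) := h1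
        _ = 4 / 3 * c₀ * clock ε₀ (j + 1) * (2 * G j) * (2 * G j + 2 * ε * G (j + 1)) := by ring
        _ < G (j + 1) := hcloseG j hj
    have hcuts := aheadCuts_of_schedule (P := P) (Bcl := Bcl) (i₀ := i₀) (X₀ := X₀) (w := w) (r := r) (c₀ := s) (ζ := ζ)
      (ustar := ustar) (n := n) hε hε₀ hs.le hVtop hG0 hVt hinit hclose0' hcloseG'
    have hprem : HopPremiseWith P Bcl shiftSetFlat ε₀ i₀ (mirrorTable ε ε) X₀ w r s ζ ustar n z S₀ s S F := ⟨hz, hkick, le_rfl, hS⟩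
    have h1 : |S i k t| ≤ 2 * G (k - 1) := hcuts (k - 1) (by omega) z S₀ s S F hprem t ht i k (by omega)
    calc ω k * |S i k t| ≤ ω k * (2 * G (k - 1)) := mul_le_mul_of_nonneg_left h1 (hω0 k)
      _ ≤ BG := hGω k hkW
      _ ≤ B := hB3

end Tube

end Summit.NavierStokesRegularity.NavierStokesRegularity.Theorems.HopTube

end
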